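import Mathlib.Analysis.Calculus.ParametricIntegral
import Mathlib.Analysis.InnerProductSpace.Calculus
import Mathlib.Analysis.Calculus.Deriv.Shift
import Summits.AtomisticToContinuum.BoseEinsteinCondensation.Theorems.BECThomsonPrincipleDensityResponseKineticFlattening
import Literature.MathematicalPhysics.QuantumManyBody.LangevinGenerator

/-!
# Route `BECThomsonPrinciple`, crux `DensityResponse` (stmt-AtomisticToContinuum-9481),
# line `force-balance-constitutive` — sub-goal `stub_kineticVariation` of stub S1
# (`TransportStationary`)

THE FIRST VARIATION OF THE KINETIC ENERGY ALONG THE TRANSPORT. For `L > 0`, a mode `n ≠ 0`, an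
admissible periodic state `Φ` and every flow time `τ`,

  `d/dt|_{t=τ} ∫_cell |∇Φ^t|² = -(K_k(Φ^τ) + (|k|²/4) m(Φ^τ))`

(`hasDerivAt_kinetic_transport`), where `Φ^t = transportFun L n t Φ.ψ` is the transported wave
function, `Φ^τ = Φ.transport hL hn τ` the transported state
(`Theorems/BECThomsonPrincipleDensityResponseTransportedState.lean`), `K_k` the kinetic stress wave and
`m` the density wave (`Theorems/BECThomsonPrincipleDensityResponseDefs.lean`): the kinetic part of the
hypervirial identity `dE/dτ = -⟨[H, D]⟩`, `D = U·∇ + ½ div U`, i.e. `⟨[-Δ, D]⟩ = K_k + (|k|²/4) m`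
(inner variations: Hirschfelder, J. Chem. Phys. 33 (1960) 1462; Epstein–Hirschfelder, Phys. Rev. 123
(1961) 1495). Steps:

* by the FLATTENING of `Theorems/BECThomsonPrincipleDensityResponseKineticFlattening.lean`,
  `∫_cell |∇φ^h|² = ∫_cell flatKineticDensity L n φ h`, whose integrand is an explicit smooth function
  of `h` through `cosh h`, `sinh h` with coefficients `φ(Y)`, `∇φ(Y)`; its `h`-derivative
  `flatKineticDeriv` (chain rule for `|·|²` in the real inner product of `ℂ`) is jointly continuous in
  `(h, Y)` for `φ ∈ C¹`, hence bounded on `[-1, 1] × cell`, and DIFFERENTIATION UNDER THE INTEGRAL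
  (`hasDerivAt_integral_of_dominated_loc_of_deriv_le`) gives `d/dh|₀ ∫ flatKineticDensity = ∫ flatKineticDeriv 0`;
* AT `h = 0`: `flatKineticDeriv 0 = ∑ᵢ [-2cos θᵢ |k·∇ᵢφ|²/|k|² + sin θᵢ ⟨k·∇ᵢφ, φ⟩]`
  (`k·∇ᵢφ = ∑_c k_c ∂_{i,c}φ`); the first term integrates to `-K_k(φ)`;
* TORUS INTEGRATION BY PARTS (`integral_cellN_pderiv_eq_zero`) for `Gᵢ = sin θᵢ |φ|²`:
  `0 = ∫ k·∇ᵢ Gᵢ = ∫ [|k|² cos θᵢ |φ|² + 2 sin θᵢ ⟨φ, k·∇ᵢφ⟩]`, so the second term integrates to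
  `-(|k|²/4) m(φ)`;
* the GROUP LAW `Φ^t = (Φ^τ)^{t-τ}` (`transportFun_transportFun`) transfers the derivative at `h = 0`
  for the state `Φ^τ` to the derivative at `t = τ`.

The registered sub-goal `stub_kineticVariation` is the displayed derivative. Elementary calculus and
measure theory; no named facts.
-/

namespace Summit.AtomisticToContinuum.BoseEinsteinCondensation.Cruxes.DensityResponse.ForceBalanceConstitutive

noncomputable section

open Real MeasureTheory Filter Set Metric
open scoped ENNReal Topology RealInnerProductSpace
open Literature.MathematicalPhysics.QuantumManyBody.BoseGas

variable {N : ℕ} {L : ℝ} {n : Fin 3 → ℤ}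

/-! ### The `h`-derivative of the flattened kinetic density -/

/-- THE `h`-DERIVATIVE OF THE FLATTENED KINETIC DENSITY:
`∑ᵢ ∑_c 2⟨Aᵢ_c + aᵢ(h) k·∇ᵢφ + bᵢ(h) φ, aᵢ'(h) k·∇ᵢφ + bᵢ'(h) φ⟩` (real inner product of `ℂ`), with
`Aᵢ_c = ∂_{i,c}φ(Y)`, `aᵢ(h) = (cosh h - cos θᵢ sinh h - 1) k_c/|k|²`, `bᵢ(h) = sinh h sin θᵢ k_c/2`. -/
def flatKineticDeriv (L : ℝ) (n : Fin 3 → ℤ) (φ : Config N → ℂ) (h : ℝ) (Y : Config N) : ℝ :=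
  ∑ i : Fin N, ∑ c : Fin 3, 2 * ⟪fderiv ℝ φ Y (Pi.single i (EuclideanSpace.single c 1)) +
    ((cosh h - cos (phase L n Y i) * sinh h - 1) * (2 * π / L * (n c : ℝ)) / ksq L n) •
      kDeriv L n φ Y i +
    (sinh h * sin (phase L n Y i) * (2 * π / L * (n c : ℝ)) / 2) • φ Y,
    ((sinh h - cos (phase L n Y i) * cosh h) * (2 * π / L * (n c : ℝ)) / ksq L n) •
      kDeriv L n φ Y i +
    (cosh h * sin (phase L n Y i) * (2 * π / L * (n c : ℝ)) / 2) • φ Y⟫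

/-- The curve `h ↦ A + a(h) B + b(h) C` of one summand and its derivative. [folklore] -/
theorem hasDerivAt_flatCurve (A B C : ℂ) (θ kc q h : ℝ) :
    HasDerivAt (fun t : ℝ => A + ((cosh t - cos θ * sinh t - 1) * kc / q) • B +
        (sinh t * sin θ * kc / 2) • C)
      (((sinh h - cos θ * cosh h) * kc / q) • B + (cosh h * sin θ * kc / 2) • C) h := by
  have ha : HasDerivAt (fun t : ℝ => (cosh t - cos θ * sinh t - 1) * kc / q)
      ((sinh h - cos θ * cosh h) * kc / q) h :=
    ((((hasDerivAt_cosh h).sub ((hasDerivAt_sinh h).const_mul (cos θ))).sub_const 1).mul_const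
      kc).div_const q
  have hb : HasDerivAt (fun t : ℝ => sinh t * sin θ * kc / 2) (cosh h * sin θ * kc / 2) h :=
    (((hasDerivAt_sinh h).mul_const _).mul_const _).div_const 2
  exact ((ha.smul_const B).const_add A).add (hb.smul_const C)

/-- `∂_h flatKineticDensity = flatKineticDeriv`, pointwise in `Y`, at every `h`. [folklore] -/
theorem hasDerivAt_flatKineticDensity (L : ℝ) (n : Fin 3 → ℤ) (φ : Config N → ℂ) (Y : Config N)
    (h : ℝ) :
    HasDerivAt (fun t : ℝ => flatKineticDensity L n φ t Y) (flatKineticDeriv L n φ h Y) h := by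
  unfold flatKineticDensity flatKineticDeriv
  refine HasDerivAt.fun_sum fun i _ => HasDerivAt.fun_sum fun c _ => ?_
  exact (hasDerivAt_flatCurve _ _ _ _ _ _ h).norm_sq

/-- `Y ↦ flatKineticDensity L n φ h Y` is continuous for `φ ∈ C¹`. [folklore] -/
theorem continuous_flatKineticDensity (L : ℝ) (n : Fin 3 → ℤ) {φ : Config N → ℂ}
    (hφ : ContDiff ℝ 1 φ) (h : ℝ) : Continuous fun Y => flatKineticDensity L n φ h Y := by
  have hd : Continuous (fderiv ℝ φ) := hφ.continuous_fderiv one_ne_zero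
  have hA : ∀ (i : Fin N) (c : Fin 3), Continuous fun Y : Config N =>
      fderiv ℝ φ Y (Pi.single i (EuclideanSpace.single c 1)) := fun i c =>
    hd.clm_apply continuous_const
  have hK : ∀ i : Fin N, Continuous fun Y : Config N => kDeriv L n φ Y i := fun i =>
    hd.clm_apply continuous_const
  have hφc : Continuous φ := hφ.continuous
  have hθ : ∀ i : Fin N, Continuous fun Y : Config N => phase L n Y i := continuous_phase L n
  unfold flatKineticDensity
  fun_prop

/-- `(h, Y) ↦ flatKineticDeriv L n φ h Y` is jointly continuous for `φ ∈ C¹`. [folklore] -/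
theorem continuous_flatKineticDeriv_uncurry (L : ℝ) (n : Fin 3 → ℤ) {φ : Config N → ℂ}
    (hφ : ContDiff ℝ 1 φ) : Continuous fun p : ℝ × Config N => flatKineticDeriv L n φ p.1 p.2 := by
  have hd : Continuous (fderiv ℝ φ) := hφ.continuous_fderiv one_ne_zero
  have hA : ∀ (i : Fin N) (c : Fin 3), Continuous fun p : ℝ × Config N =>
      fderiv ℝ φ p.2 (Pi.single i (EuclideanSpace.single c 1)) := fun i c =>
    (hd.comp continuous_snd).clm_apply continuous_const
  have hK : ∀ i : Fin N, Continuous fun p : ℝ × Config N => kDeriv L n φ p.2 i := fun i =>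
    (hd.comp continuous_snd).clm_apply continuous_const
  have hφc : Continuous fun p : ℝ × Config N => φ p.2 := hφ.continuous.comp continuous_snd
  have hθ : ∀ i : Fin N, Continuous fun p : ℝ × Config N => phase L n p.2 i := fun i =>
    (continuous_phase L n i).comp continuous_snd
  unfold flatKineticDeriv
  fun_prop

/-- **DIFFERENTIATION UNDER THE INTEGRAL**: for `φ ∈ C¹`,
`d/dh|₀ ∫_cell flatKineticDensity L n φ h = ∫_cell flatKineticDeriv L n φ 0` (the derivative density is
bounded on `[-1,1] × cell` by joint continuity; dominated differentiation on the finite cell).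
[folklore] -/
theorem hasDerivAt_integral_flatKineticDensity (L : ℝ) (n : Fin 3 → ℤ) {φ : Config N → ℂ}
    (hφ : ContDiff ℝ 1 φ) :
    HasDerivAt (fun t : ℝ => ∫ Y in cellN N L, flatKineticDensity L n φ t Y)
      (∫ Y in cellN N L, flatKineticDeriv L n φ 0 Y) 0 := by
  have hK : IsCompact (Icc (-1 : ℝ) 1 ×ˢ closedBall (0 : Config N) (2 * |L|)) :=
    isCompact_Icc.prod (isCompact_closedBall _ _)
  have hc := continuous_flatKineticDeriv_uncurry L n hφ
  obtain ⟨M, hM⟩ := hK.exists_bound_of_continuousOn hc.continuousOn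
  have hmain := hasDerivAt_integral_of_dominated_loc_of_deriv_le
    (μ := volume.restrict (cellN N L)) (x₀ := (0 : ℝ)) (s := ball (0 : ℝ) 1)
    (F := fun (t : ℝ) (Y : Config N) => flatKineticDensity L n φ t Y)
    (F' := fun (t : ℝ) (Y : Config N) => flatKineticDeriv L n φ t Y)
    (bound := fun _ => M) (ball_mem_nhds (0 : ℝ) one_pos)
    (Eventually.of_forall fun t => (continuous_flatKineticDensity L n hφ t).aestronglyMeasurable)
    (integrableOn_cellN (continuous_flatKineticDensity L n hφ 0) L)
    ((hc.comp (continuous_const.prodMk continuous_id)).aestronglyMeasurable)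
    (by
      filter_upwards [ae_restrict_mem (measurableSet_cellN N L)] with Y hY
      intro t ht
      have ht' : t ∈ Icc (-1 : ℝ) 1 := by
        rw [Real.ball_eq_Ioo] at ht
        exact Ioo_subset_Icc_self (by simpa using ht)
      exact hM (t, Y) ⟨ht', cellN_subset_closedBall N L hY⟩)
    (integrableOn_cellN continuous_const L)
    (Eventually.of_forall fun Y t _ => hasDerivAt_flatKineticDensity L n φ Y t)
  exact hmain.2

/-! ### The derivative density at `h = 0` -/

/-- `⟨k·∇ᵢφ, z⟩ = ∑_c k_c ⟨∂_{i,c}φ, z⟩` (`k·∇ᵢ = ∑_c k_c ∂_{i,c}`). [folklore] -/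
theorem inner_kDeriv_left (L : ℝ) (n : Fin 3 → ℤ) (φ : Config N → ℂ) (Y : Config N) (i : Fin N)
    (z : ℂ) : ⟪kDeriv L n φ Y i, z⟫ =
      ∑ c : Fin 3, 2 * π / L * (n c : ℝ) * ⟪fderiv ℝ φ Y (Pi.single i (EuclideanSpace.single c 1)), z⟫ := by
  rw [kDeriv_eq_sum, sum_inner]
  simp only [real_inner_smul_left]

/-- THE DERIVATIVE DENSITY AT `h = 0`:
`flatKineticDeriv 0 = ∑ᵢ [-(2cos θᵢ |k·∇ᵢφ|²/|k|²) + sin θᵢ ⟨k·∇ᵢφ, φ⟩]`. [folklore] -/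
theorem flatKineticDeriv_zero (L : ℝ) (n : Fin 3 → ℤ) (φ : Config N → ℂ) (Y : Config N) :
    flatKineticDeriv L n φ 0 Y = ∑ i, (-(2 * cos (phase L n Y i) * (‖kDeriv L n φ Y i‖ ^ 2 / ksq L n)) +
      sin (phase L n Y i) * ⟪kDeriv L n φ Y i, φ Y⟫) := by
  unfold flatKineticDeriv
  simp only [cosh_zero, sinh_zero, mul_zero, mul_one, sub_zero, sub_self, zero_mul, zero_div,
    zero_smul, add_zero, zero_sub, one_mul]
  refine Finset.sum_congr rfl fun i _ => ?_
  simp only [inner_add_right, real_inner_smul_right]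
  rw [← real_inner_self_eq_norm_sq, inner_kDeriv_left L n φ Y i (kDeriv L n φ Y i),
    inner_kDeriv_left L n φ Y i (φ Y), div_eq_mul_inv (∑ c, _), Finset.sum_mul,
    Finset.mul_sum, Finset.mul_sum, ← Finset.sum_neg_distrib, ← Finset.sum_add_distrib]
  refine Finset.sum_congr rfl fun c _ => ?_
  ring

/-! ### Torus integration by parts for the source term -/

/-- `D g(Y)[k in slot i] = ∑_c k_c ∂_{i,c} g(Y)` for a real function (linearity). [folklore] -/
theorem fderiv_apply_single_kvec (L : ℝ) (n : Fin 3 → ℤ) (g : Config N → ℝ) (Y : Config N)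
    (i : Fin N) : fderiv ℝ g Y (Pi.single i (kvec L n)) =
      ∑ c : Fin 3, 2 * π / L * (n c : ℝ) * pderiv i c g Y := by
  -- adapted from `kDeriv_eq_sum` (Theorems/BECThomsonPrincipleDensityResponseKineticSignCoherence.lean)
  let ℓ : Space →ₗ[ℝ] ℝ :=
    (fderiv ℝ g Y : Config N →ₗ[ℝ] ℝ).comp (LinearMap.single ℝ (fun _ : Fin N => Space) i)
  have hℓ : ∀ y : Space, ℓ y = fderiv ℝ g Y (Pi.single i y) := fun _ => rfl
  calc fderiv ℝ g Y (Pi.single i (kvec L n)) = ℓ (kvec L n) := (hℓ _).symm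
    _ = ∑ c : Fin 3, (2 * π / L * (n c : ℝ)) • ℓ (EuclideanSpace.single c (1 : ℝ)) := by
        rw [kvec_eq_sum, map_sum]
        simp only [map_smul]
    _ = _ := by simp only [hℓ, smul_eq_mul, pderiv]

/-- TORUS INTEGRATION BY PARTS along `k·∇ᵢ`: `∫_cell k·∇ᵢ G = 0` for a `C¹` lattice-periodic `G`
(`integral_cellN_pderiv_eq_zero` coordinate by coordinate). [folklore] -/
theorem integral_fderiv_apply_single_kvec_eq_zero (hL : 0 < L) (n : Fin 3 → ℤ) {G : Config N → ℝ}
    (hG : ContDiff ℝ 1 G) (hper : IsLatticePeriodic L G) (i : Fin N) :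
    ∫ Y in cellN N L, fderiv ℝ G Y (Pi.single i (kvec L n)) = 0 := by
  simp_rw [fderiv_apply_single_kvec]
  rw [integral_finsetSum _ fun c _ => (integrableOn_cellN (continuous_pderiv hG i c) L).const_mul _]
  refine Finset.sum_eq_zero fun c _ => ?_
  rw [integral_const_mul, integral_cellN_pderiv_eq_zero hL hG hper i c, mul_zero]

/-- The divergence identity for the source term, pointwise: for `φ` differentiable at `Y`,
`k·∇ᵢ (sin θᵢ |φ|²)(Y) = |k|² cos θᵢ |φ(Y)|² + sin θᵢ · 2⟨φ(Y), k·∇ᵢφ(Y)⟩`. [folklore] -/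
theorem fderiv_sin_phase_mul_norm_sq (L : ℝ) (n : Fin 3 → ℤ) {φ : Config N → ℂ} {Y : Config N}
    (hφ : DifferentiableAt ℝ φ Y) (i : Fin N) :
    fderiv ℝ (fun Y => sin (phase L n Y i) * ‖φ Y‖ ^ 2) Y (Pi.single i (kvec L n)) =
      ksq L n * cos (phase L n Y i) * ‖φ Y‖ ^ 2 +
        sin (phase L n Y i) * (2 * ⟪φ Y, kDeriv L n φ Y i⟫) := by
  have hθ : HasFDerivAt (fun Y : Config N => phase L n Y i)
      ((kdual L n).comp (ContinuousLinearMap.proj i)) Y :=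
    ((kdual L n).hasFDerivAt).comp Y (hasFDerivAt_apply i Y)
  have h1 := (hasDerivAt_sin (phase L n Y i)).comp_hasFDerivAt Y hθ
  have h2 : HasFDerivAt (fun Y => ‖φ Y‖ ^ 2) (2 • (innerSL ℝ (φ Y)).comp (fderiv ℝ φ Y)) Y :=
    hφ.hasFDerivAt.norm_sq
  have h3 : HasFDerivAt (fun Y => sin (phase L n Y i) * ‖φ Y‖ ^ 2)
      (sin (phase L n Y i) • (2 • (innerSL ℝ (φ Y)).comp (fderiv ℝ φ Y)) +
        ‖φ Y‖ ^ 2 • (cos (phase L n Y i) • (kdual L n).comp (ContinuousLinearMap.proj i))) Y :=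
    h1.mul h2
  rw [h3.fderiv]
  simp only [add_apply, FunLike.coe_smul, Pi.smul_apply, ContinuousLinearMap.coe_comp,
    Function.comp_apply, ContinuousLinearMap.proj_apply, smul_eq_mul, Pi.single_eq_same, kdual_kvec]
  simp only [nsmul_eq_mul, Nat.cast_ofNat, innerSL_apply_apply]
  rw [kDeriv]
  ring

/-- `sin θᵢ |φ|²` is `C¹` for `φ ∈ C¹`. [folklore] -/
theorem contDiff_sin_phase_mul_norm_sq (L : ℝ) (n : Fin 3 → ℤ) {φ : Config N → ℂ}
    (hφ : ContDiff ℝ 1 φ) (i : Fin N) :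
    ContDiff ℝ 1 fun Y => sin (phase L n Y i) * ‖φ Y‖ ^ 2 :=
  (contDiff_sin.comp (contDiff_phase L n i)).mul (hφ.norm_sq ℝ)

/-- `sin θᵢ |φ|²` is lattice periodic for lattice-periodic `φ`. [folklore] -/
theorem isLatticePeriodic_sin_phase_mul_norm_sq (L : ℝ) (n : Fin 3 → ℤ) {φ : Config N → ℂ}
    (hper : ∀ (X : Config N) (i : Fin N) (c : Fin 3),
      φ (X + Pi.single i (EuclideanSpace.single c L)) = φ X) (i : Fin N) :
    IsLatticePeriodic L fun Y => sin (phase L n Y i) * ‖φ Y‖ ^ 2 := by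
  intro X j c
  obtain ⟨m, hm⟩ := exists_phase_add_single L n X j c i
  simp only [hm, sin_add_int_mul_two_pi, hper]

/-- **THE SOURCE TERM BY TORUS INTEGRATION BY PARTS**:
`∫_cell ∑ᵢ sin θᵢ ⟨k·∇ᵢΨ, Ψ⟩ = -(|k|²/4) m(Ψ)` for an admissible periodic state `Ψ`
(`0 = ∫ k·∇ᵢ(sin θᵢ |Ψ|²) = |k|² ∫ cos θᵢ |Ψ|² + 2 ∫ sin θᵢ ⟨Ψ, k·∇ᵢΨ⟩`). [folklore] -/
theorem integral_sum_sin_phase_inner_kDeriv (hL : 0 < L) (n : Fin 3 → ℤ) (Ψ : PeriodicTrialState N L) :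
    ∫ Y in cellN N L, ∑ i, sin (phase L n Y i) * ⟪kDeriv L n Ψ.ψ Y i, Ψ.ψ Y⟫ =
      -(ksq L n / 4) * sourceMean n Ψ := by
  have hd : Continuous (fderiv ℝ Ψ.ψ) := Ψ.contDiff.continuous_fderiv one_ne_zero
  have hK : ∀ i : Fin N, Continuous fun Y : Config N => kDeriv L n Ψ.ψ Y i := fun i =>
    hd.clm_apply continuous_const
  have hψc : Continuous Ψ.ψ := Ψ.contDiff.continuous
  have hρc : Continuous fun Y : Config N => ‖Ψ.ψ Y‖ ^ 2 := (hψc.norm).pow 2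
  have hθ : ∀ i : Fin N, Continuous fun Y : Config N => phase L n Y i := continuous_phase L n
  -- the two densities
  have hf : Continuous fun Y : Config N => (∑ i, 2 * cos (phase L n Y i)) * ‖Ψ.ψ Y‖ ^ 2 := by
    fun_prop
  have hg : Continuous fun Y : Config N => ∑ i, sin (phase L n Y i) * ⟪kDeriv L n Ψ.ψ Y i, Ψ.ψ Y⟫ :=
    continuous_finsetSum _ fun i _ => (continuous_sin.comp (hθ i)).mul ((hK i).inner hψc)
  -- the divergence, particle by particle, integrates to zero
  have h0 : ∀ i : Fin N, ∫ Y in cellN N L, (ksq L n * cos (phase L n Y i) * ‖Ψ.ψ Y‖ ^ 2 +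
      sin (phase L n Y i) * (2 * ⟪Ψ.ψ Y, kDeriv L n Ψ.ψ Y i⟫)) = 0 := fun i => by
    rw [← integral_fderiv_apply_single_kvec_eq_zero hL n (contDiff_sin_phase_mul_norm_sq L n Ψ.contDiff i)
      (isLatticePeriodic_sin_phase_mul_norm_sq L n Ψ.periodic i) i]
    exact integral_congr_ae (Eventually.of_forall fun Y =>
      (fderiv_sin_phase_mul_norm_sq L n ((Ψ.contDiff.differentiable one_ne_zero) Y) i).symm)
  -- pointwise: ∑ᵢ divᵢ = (|k|²/2) f + 2 g
  have hpt : ∀ Y : Config N, ∑ i, (ksq L n * cos (phase L n Y i) * ‖Ψ.ψ Y‖ ^ 2 +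
      sin (phase L n Y i) * (2 * ⟪Ψ.ψ Y, kDeriv L n Ψ.ψ Y i⟫)) =
      ksq L n / 2 * ((∑ i, 2 * cos (phase L n Y i)) * ‖Ψ.ψ Y‖ ^ 2) +
        2 * ∑ i, sin (phase L n Y i) * ⟪kDeriv L n Ψ.ψ Y i, Ψ.ψ Y⟫ := fun Y => by
    rw [Finset.sum_mul, Finset.mul_sum, Finset.mul_sum, ← Finset.sum_add_distrib]
    refine Finset.sum_congr rfl fun i _ => ?_
    rw [real_inner_comm (Ψ.ψ Y)]
    ring
  have hdi : ∀ i : Fin N, Integrable (fun Y : Config N => ksq L n * cos (phase L n Y i) * ‖Ψ.ψ Y‖ ^ 2 +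
      sin (phase L n Y i) * (2 * ⟪Ψ.ψ Y, kDeriv L n Ψ.ψ Y i⟫)) (volume.restrict (cellN N L)) :=
    fun i => integrableOn_cellN (((continuous_const.mul (continuous_cos.comp (hθ i))).mul hρc).add
      ((continuous_sin.comp (hθ i)).mul (continuous_const.mul (hψc.inner (hK i))))) L
  have hsum : ∫ Y in cellN N L, (ksq L n / 2 * ((∑ i, 2 * cos (phase L n Y i)) * ‖Ψ.ψ Y‖ ^ 2) +
      2 * ∑ i, sin (phase L n Y i) * ⟪kDeriv L n Ψ.ψ Y i, Ψ.ψ Y⟫) = 0 := by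
    simp_rw [← hpt]
    rw [integral_finsetSum _ fun i _ => hdi i]
    exact Finset.sum_eq_zero fun i _ => h0 i
  rw [integral_add ((integrableOn_cellN hf L).const_mul _) ((integrableOn_cellN hg L).const_mul _),
    integral_const_mul, integral_const_mul] at hsum
  rw [sourceMean_eq_integral]
  linarith

/-- **THE INTEGRATED DERIVATIVE DENSITY AT `h = 0`**:
`∫_cell flatKineticDeriv L n Ψ 0 = -(K_k(Ψ) + (|k|²/4) m(Ψ))`. [folklore] -/
theorem integral_flatKineticDeriv_zero (hL : 0 < L) (n : Fin 3 → ℤ) (Ψ : PeriodicTrialState N L) :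
    ∫ Y in cellN N L, flatKineticDeriv L n Ψ.ψ 0 Y =
      -(kineticStressWave n Ψ + ksq L n / 4 * sourceMean n Ψ) := by
  have hd : Continuous (fderiv ℝ Ψ.ψ) := Ψ.contDiff.continuous_fderiv one_ne_zero
  have hK : ∀ i : Fin N, Continuous fun Y : Config N => kDeriv L n Ψ.ψ Y i := fun i =>
    hd.clm_apply continuous_const
  have hψc : Continuous Ψ.ψ := Ψ.contDiff.continuous
  have hθ : ∀ i : Fin N, Continuous fun Y : Config N => phase L n Y i := continuous_phase L n
  have h1 : Continuous fun Y : Config N =>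
      ∑ i, 2 * cos (phase L n Y i) * (‖kDeriv L n Ψ.ψ Y i‖ ^ 2 / ksq L n) := by
    fun_prop
  have h2 : Continuous fun Y : Config N => ∑ i, sin (phase L n Y i) * ⟪kDeriv L n Ψ.ψ Y i, Ψ.ψ Y⟫ :=
    continuous_finsetSum _ fun i _ => (continuous_sin.comp (hθ i)).mul ((hK i).inner hψc)
  have hi1 : Integrable (fun Y : Config N =>
      -∑ i, 2 * cos (phase L n Y i) * (‖kDeriv L n Ψ.ψ Y i‖ ^ 2 / ksq L n))
      (volume.restrict (cellN N L)) := integrableOn_cellN h1.neg L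
  simp_rw [flatKineticDeriv_zero, Finset.sum_add_distrib, Finset.sum_neg_distrib]
  rw [integral_add hi1 (integrableOn_cellN h2 L), integral_neg,
    integral_sum_sin_phase_inner_kDeriv hL n Ψ, kineticStressWave]
  ring

/-! ### The kinetic first variation -/

/-- **THE KINETIC FIRST VARIATION AT `h = 0`**: for `L > 0`, `n ≠ 0` and an admissible periodic state
`Ψ`, `d/dh|₀ ∫_cell |∇Ψ^h|² = -(K_k(Ψ) + (|k|²/4) m(Ψ))` (flattening, differentiation under the
integral, torus integration by parts). [folklore] -/
theorem hasDerivAt_kinetic_transport_zero (hL : 0 < L) (hn : n ≠ 0) (Ψ : PeriodicTrialState N L) :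
    HasDerivAt (fun t : ℝ => ∫ X in cellN N L, kineticDensityReal (transportFun L n t Ψ.ψ) X)
      (-(kineticStressWave n Ψ + ksq L n / 4 * sourceMean n Ψ)) 0 := by
  have hk : ksq L n ≠ 0 := (ksq_pos hL.ne' hn).ne'
  have heq : (fun t : ℝ => ∫ X in cellN N L, kineticDensityReal (transportFun L n t Ψ.ψ) X) =
      fun t : ℝ => ∫ Y in cellN N L, flatKineticDensity L n Ψ.ψ t Y :=
    funext fun t => integral_kineticDensityReal_transportFun hL hk Ψ.contDiff Ψ.periodic t
  rw [heq, ← integral_flatKineticDeriv_zero hL n Ψ]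
  exact hasDerivAt_integral_flatKineticDensity L n Ψ.contDiff

/-- **THE KINETIC FIRST VARIATION ALONG THE TRANSPORT**: for `L > 0`, `n ≠ 0`, an admissible periodic
state `Φ` and every `τ`,
`d/dt|_{t=τ} ∫_cell |∇Φ^t|² = -(K_k(Φ^τ) + (|k|²/4) m(Φ^τ))`, `Φ^τ = Φ.transport hL hn τ` (the case
`h = 0` for the state `Φ^τ`, transported by the group law `Φ^t = (Φ^τ)^{t-τ}`). [folklore] -/
theorem hasDerivAt_kinetic_transport (hL : 0 < L) (hn : n ≠ 0) (Φ : PeriodicTrialState N L) (τ : ℝ) :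
    HasDerivAt (fun t : ℝ => ∫ X in cellN N L, kineticDensityReal (transportFun L n t Φ.ψ) X)
      (-(kineticStressWave n (Φ.transport hL hn τ) +
        ksq L n / 4 * sourceMean n (Φ.transport hL hn τ))) τ := by
  have hk : ksq L n ≠ 0 := (ksq_pos hL.ne' hn).ne'
  have h0 := hasDerivAt_kinetic_transport_zero hL hn (Φ.transport hL hn τ)
  have h1 := HasDerivAt.comp_sub_const τ τ (f := fun t : ℝ =>
    ∫ X in cellN N L, kineticDensityReal (transportFun L n t (Φ.transport hL hn τ).ψ) X)
    (by rw [sub_self]; exact h0)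
  refine h1.congr_of_eventuallyEq (Eventually.of_forall fun t => ?_)
  show ∫ X in cellN N L, kineticDensityReal (transportFun L n t Φ.ψ) X =
    ∫ X in cellN N L, kineticDensityReal (transportFun L n (t - τ) (Φ.transport hL hn τ).ψ) X
  rw [PeriodicTrialState.transport_ψ, transportFun_transportFun hk, sub_add_cancel]

/-- The same for the kinetic energy `T_L(Φ^t) = cellKineticEnergy L (Φ.transport hL hn t).ψ`.
[folklore] -/
theorem hasDerivAt_cellKineticEnergy_transport (hL : 0 < L) (hn : n ≠ 0) (Φ : PeriodicTrialState N L)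
    (τ : ℝ) :
    HasDerivAt (fun t : ℝ => cellKineticEnergy L (Φ.transport hL hn t).ψ)
      (-(kineticStressWave n (Φ.transport hL hn τ) +
        ksq L n / 4 * sourceMean n (Φ.transport hL hn τ))) τ :=
  hasDerivAt_kinetic_transport hL hn Φ τ

/-! ### The registered sub-goal -/

/-- **Registered sub-goal `stub_kineticVariation` of S1** (line `force-balance-constitutive`, crux
stmt-AtomisticToContinuum-9481): for `L > 0`, a mode `n ≠ 0`, an admissible periodic state `Φ` and
every flow time `τ`, the kinetic energy of the transported wave function `Φ^t = transportFun L n t Φ.ψ`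
has `t`-derivative `-(K_k(Φ^τ) + (|k|²/4) m(Φ^τ))` at `t = τ` — the kinetic stress wave plus the
kinetic energy of the half-density Jacobian, evaluated at the transported state `Φ^τ`. [folklore] -/
theorem stub_kineticVariation : ∀ (N : ℕ) (L : ℝ) (n : Fin 3 → ℤ) (hL : 0 < L) (hn : n ≠ 0)
    (Φ : Literature.MathematicalPhysics.QuantumManyBody.BoseGas.PeriodicTrialState N L) (τ : ℝ),
    HasDerivAt (fun t : ℝ => ∫ X in Literature.MathematicalPhysics.QuantumManyBody.BoseGas.cellN N L,
        Literature.MathematicalPhysics.QuantumManyBody.BoseGas.kineticDensityReal (transportFun L n t Φ.ψ) X)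
      (-(kineticStressWave n (Φ.transport hL hn τ) +
        ksq L n / 4 * sourceMean n (Φ.transport hL hn τ))) τ :=
  fun _ _ _ hL hn Φ τ => hasDerivAt_kinetic_transport hL hn Φ τ

end

end Summit.AtomisticToContinuum.BoseEinsteinCondensation.Cruxes.DensityResponse.ForceBalanceConstitutive
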